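import Summits.BirchSwinnertonDyer.BirchSwinnertonDyer.Theorems.AdditiveKolyvaginRoadManinFrameResidueProperRTameTwist
import Summits.BirchSwinnertonDyer.BirchSwinnertonDyer.Theorems.AdditiveKolyvaginRoadManinFrameResidueProperRTameTwistPlusCharacter
import Summits.BirchSwinnertonDyer.BirchSwinnertonDyer.Theorems.AdditiveKolyvaginRoadManinFrameResidueProperRTameTwistMod4
import Summits.BirchSwinnertonDyer.BirchSwinnertonDyer.Theorems.AdditiveKolyvaginRoadManinFrameResidueProperRTameTwistSplit4
import HarnessLib

/-!
# Route `AdditiveKolyvaginRoad`, crux `ManinFrameResidueProperR` (stmt-BirchSwinnertonDyer-20709), line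
# `birth`, stub TDS: the tame-twist lever on the LARGER locus (A⁺) «no `ℓ ∥ N` with `ℓ ≡ ±a_ℓ (mod p)»,
# part 2 — every `γ`, Manin's `p`-part at a lattice-optimal datum, the frame corollaries — `--supports`

Cell `pub/bsd-wall`, seat `bsd-wall-manin-p1` g3. THEOREMS ONLY (the Literature fact
`kato_neron_isIntegral_twistedSymbolSum_of_additive` is the hypothesis `hK`). Same architecture as
`…RTameTwistSymbols` / `…RTameTwist`, with the auxiliary primes `d′ ≡ 3 (mod 4)` of `…RTameTwistMod4`, the
4-adjustable splitting of `…RTameTwistSplit4`, and the unit Euler factors of `…RTameTwistPlusCharacter`, so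
that the hypothesis is **(A⁺)**: `(ℓ/a_ℓ(W))² ≠ 1 (mod p)` for every `ℓ ∥ N(W)`. Main results:
`not_dvd_c_of_tameTwist_of_sq_ne_one` (fact ∧ `Addv` ∧ `Irr` ∧ `p > 7` ∧ `p² ∣ N` ∧ (A⁺) ⟹ `p ∤ c` at every
lattice-optimal datum), `twistDegreeStep_of_tameTwist_of_sq_ne_one` (the conclusion of `stub_twistDegreeStep`
at every AKR frame with (A⁺)), `exists_member_not_dvd_c_…`, `forall_latticeOptimal_not_dvd_c_…`. Census
(Cremona; Manin register of cell `bsd-wall`; `p ≥ 11` additive rank-1 residue cells, `N ≤ 5·10⁵`): (A⁺) holds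
on 424 of 458 cells and on 7 of the 9 outside-print cells (the open Manin residue); the remaining wall is
`ℓ ≡ a_ℓ (mod p)`. No `sorry`; nothing is closed.
-/

set_option autoImplicit false
set_option linter.dupNamespace false

noncomputable section

open scoped Classical MatrixGroups

open WeierstrassCurve NumberField Literature.NumberTheory.EllipticCurves
  Literature.NumberTheory.EllipticCurves.ModularForms
  Literature.NumberTheory.EllipticCurves.Rank1Residual
  Literature.NumberTheory.DiophantineGeometry IsDedekindDomain Rat.HeightOneSpectrum
  Summit.BirchSwinnertonDyer.Rank1Residual Summit.BirchSwinnertonDyer.Rank1Residual.Additive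
  CongruenceSubgroup Complex

namespace Summit.BirchSwinnertonDyer.BirchSwinnertonDyer.Theorems.ManinFrameResidueProperRTameTwist

section SymbolsPlus

variable {W : WeierstrassCurve ℚ} [W.IsElliptic] [W.IsGloballyMinimal] {N : ℕ} [NeZero N]
  {p : ℕ} [hp : Fact p.Prime]

/-- **One 4-adjustable `γ`, (A⁺) form.** Under the hypotheses of `pint_twistedSymbolSum_div4` (fact, `p > 7`
additive, `Irr`, `p² ∣ N`, (A⁺)), for `γ = (a b; c d) ∈ Γ₀(N)` 4-ADJUSTABLE (`c ≠ 0`, `d ≢ 1 (mod p)`,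
`d ≢ 1 (mod r)` for odd primes `r ∣ p − 1` dividing `c`, `4 ∣ c ⟹ d ≡ 3 (mod 4)`):
`Im {∞, γ∞}_f / |Ω⁻(W)|` is `p`-integral. [cite: Manin1972, Prop. 1.4 / Thm. 1.6]
[cite: Kato2004Asterisque, Thm. 9.7 (p. 189)] -/
theorem pint_im_cuspSymbol_of_adjustable4 (hK : kato_neron_isIntegral_twistedSymbolSum_of_additive)
    (hp7 : 7 < p) (hadd : Addv W p) (hirr : Irr W p) (f : CuspForm (Gamma0 N) 2) (hf : IsNewformOf W f)
    (hpN : p ^ 2 ∣ N)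
    (hA : ∀ ℓ ∈ N.primeFactors, ¬ ℓ ^ 2 ∣ N →
      ((ℓ : ZMod p) / (W.LFunction ℓ : ZMod p)) ^ 2 ≠ 1)
    {ϖ : ℚ} (hϖ : (ϖ : ℝ) * W.imaginaryPeriodRat = minusPeriod f)
    (γ : Gamma0 N) (hc : (γ : SL(2, ℤ)) 1 0 ≠ 0) (hdp : ¬ (p : ℤ) ∣ (γ : SL(2, ℤ)) 1 1 - 1)
    (hdr : ∀ r : ℕ, r.Prime → r ≠ 2 → r ∣ p - 1 → (r : ℤ) ∣ (γ : SL(2, ℤ)) 1 0 →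
      ¬ (r : ℤ) ∣ (γ : SL(2, ℤ)) 1 1 - 1)
    (h4γ : (4 : ℤ) ∣ (γ : SL(2, ℤ)) 1 0 → (4 : ℤ) ∣ (γ : SL(2, ℤ)) 1 1 - 3) :
    ∃ s : ℕ, ¬ p ∣ s ∧ IsIntegral ℤ ((s : ℂ) *
      ((((cuspSymbol f γ).im : ℝ) : ℂ) / (W.imaginaryPeriodRat : ℂ))) := by
  have hpP : p.Prime := hp.out
  have hpN1 : p ∣ N := (dvd_pow_self p two_ne_zero).trans hpN
  have hreal : ∀ n, (cuspCoeff f n).im = 0 := cuspCoeff_im_eq_zero_of_coeffField_eq_bot hf.coeffField_eq_bot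
  obtain ⟨k, d', hd', hNd', hd'eq, hpd', hrd', h4d'⟩ :=
    exists_prime_eq_add_mul_of_adjustable4 hpP hpN1 γ hc hdp hdr h4γ
  haveI : NeZero d' := ⟨hd'.ne_zero⟩
  -- `δ = γ T^k`: same first column, lower-right entry `d′`
  set δ : Gamma0 N := γ * ⟨ModularGroup.T ^ k, Literature.NumberTheory.Automorphic.T_zpow_mem_Gamma0 k⟩
    with hδdef
  obtain ⟨h00, h10, h01, h11⟩ := entries_mul_T_zpow (γ : SL(2, ℤ)) k
  have hδ : (δ : SL(2, ℤ)) = (γ : SL(2, ℤ)) * ModularGroup.T ^ k := rfl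
  have hd11 : ((δ : SL(2, ℤ)) 1 1 : ℤ) = d' := by rw [hδ, h11, hd'eq]; ring
  have hcs : cuspSymbol f δ = cuspSymbol f γ := by
    simp only [cuspSymbol, hδ, h00, h10]
  obtain ⟨b', hb'def⟩ : ∃ b' : ℤ, b' = (δ : SL(2, ℤ)) 0 1 := ⟨_, rfl⟩
  -- Manin: `{∞, b′/d′} = {∞, δ∞} + {∞, 0}`
  have hne : (((δ : SL(2, ℤ)) 1 0 : ℤ) : ℚ) * 0 + (((δ : SL(2, ℤ)) 1 1 : ℤ) : ℚ) ≠ 0 := by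
    rw [mul_zero, zero_add, hd11]; exact_mod_cast hd'.ne_zero
  have hM := modularSymbol_gamma0_smul_holds f δ 0 hne
  rw [mul_zero, zero_add, mul_zero, zero_add, hd11, hcs, ← hb'def, Int.cast_natCast] at hM
  -- `b′` is a unit mod `d′`
  have hbu : IsUnit ((b' : ZMod d')) := by
    rw [ZMod.coe_int_isUnit_iff_isCoprime]
    refine ⟨(δ : SL(2, ℤ)) 0 0, -(δ : SL(2, ℤ)) 1 0, ?_⟩
    have hdet := entry_det δ
    rw [hd11, ← hb'def] at hdet
    linear_combination hdet
  -- the odd-character identity, divided by `|Ω⁻| i`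
  have hid := two_mul_sum_odd_twistedSymbolSum hd' f hreal b' hbu
  rw [hM, Complex.sub_conj] at hid
  -- each summand divided by `Ω i` is `p`-integral
  have hΩ : 0 < W.imaginaryPeriodRat := W.imaginaryPeriodRat_pos
  have hΩ0 : (W.imaginaryPeriodRat : ℂ) ≠ 0 := by exact_mod_cast hΩ.ne'
  have hsum : ∃ s : ℕ, ¬ p ∣ s ∧ IsIntegral ℤ ((s : ℂ) *
      ∑ χ ∈ (Finset.univ : Finset (DirichletCharacter ℂ d')) with χ.Odd,
        χ ((b' : ZMod d'))⁻¹ * (twistedSymbolSum f χ / ((W.imaginaryPeriodRat : ℂ) * I))) := by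
    refine pint_sum hpP _ _ fun χ hχ ↦ pint_mul hpP (pint_of_isIntegral hpP (isIntegral_apply hd' χ _)) ?_
    exact pint_twistedSymbolSum_div4 hK hp7 hadd hirr f hf hpN hA hd' hNd' hpd' hrd' h4d' hϖ χ
      (Finset.mem_filter.mp hχ).2
  -- rewrite the sum as `(d′−1) · Im/Ω`
  have hsum_eq : ∑ χ ∈ (Finset.univ : Finset (DirichletCharacter ℂ d')) with χ.Odd,
      χ ((b' : ZMod d'))⁻¹ * (twistedSymbolSum f χ / ((W.imaginaryPeriodRat : ℂ) * I)) =
      ((d' - 1 : ℕ) : ℂ) * ((((cuspSymbol f γ + modularSymbol f 0).im : ℝ) : ℂ) /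
        (W.imaginaryPeriodRat : ℂ)) := by
    have h2 : (2 : ℂ) ≠ 0 := two_ne_zero
    simp_rw [← mul_div_assoc, ← Finset.sum_div]
    rw [show ∑ χ ∈ (Finset.univ : Finset (DirichletCharacter ℂ d')) with χ.Odd,
        χ ((b' : ZMod d'))⁻¹ * twistedSymbolSum f χ =
        ((d' - 1 : ℕ) : ℂ) * ((2 * (cuspSymbol f γ + modularSymbol f 0).im : ℝ) : ℂ) * I / 2 by
      rw [eq_div_iff h2, mul_comm _ (2 : ℂ), hid]; ring]
    push_cast
    field_simp
  rw [hsum_eq] at hsum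
  have him0 : (modularSymbol f 0).im = 0 := by
    have := modularSymbol_neg_eq_conj_holds f hreal 0
    rw [neg_zero] at this
    exact Complex.conj_eq_iff_im.mp this.symm
  rw [Complex.add_im, him0, add_zero] at hsum
  exact pint_of_pint_natCast_mul hpP hpd' hsum

/-- **Every `γ ∈ Γ₀(N)`, (A⁺) form**: `Im {∞, γ∞}_f / |Ω⁻(W)|` is `p`-integral — `γ⁴ = γ₁ γ₂` with
4-adjustable `γᵢ` (`…RTameTwistSplit4`), `{∞, ·∞}_f` a homomorphism (`cuspSymbol_mul_holds`), `p ∤ 4`.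
[cite: Manin1972, Prop. 1.4 / Thm. 1.6] -/
theorem pint_im_cuspSymbol4 (hK : kato_neron_isIntegral_twistedSymbolSum_of_additive)
    (hp7 : 7 < p) (hadd : Addv W p) (hirr : Irr W p) (f : CuspForm (Gamma0 N) 2) (hf : IsNewformOf W f)
    (hpN : p ^ 2 ∣ N)
    (hA : ∀ ℓ ∈ N.primeFactors, ¬ ℓ ^ 2 ∣ N →
      ((ℓ : ZMod p) / (W.LFunction ℓ : ZMod p)) ^ 2 ≠ 1)
    {ϖ : ℚ} (hϖ : (ϖ : ℝ) * W.imaginaryPeriodRat = minusPeriod f) (γ : Gamma0 N) :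
    ∃ s : ℕ, ¬ p ∣ s ∧ IsIntegral ℤ ((s : ℂ) *
      ((((cuspSymbol f γ).im : ℝ) : ℂ) / (W.imaginaryPeriodRat : ℂ))) := by
  have hpP : p.Prime := hp.out
  have hp5 : 5 ≤ p := by omega
  have hp4 : ¬ p ∣ 4 := fun h ↦ by have := Nat.le_of_dvd four_pos h; omega
  have hpN1 : p ∣ N := (dvd_pow_self p two_ne_zero).trans hpN
  -- `{∞, γ⁴∞} = 4 {∞, γ∞}`
  have h4 : cuspSymbol f (γ ^ 4) = 4 * cuspSymbol f γ := by
    have := map_pow (cuspSymbolHom f) γ 4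
    simp only [cuspSymbolHom_apply] at this
    have h := congrArg Multiplicative.toAdd this
    rw [toAdd_ofAdd, toAdd_pow, toAdd_ofAdd, nsmul_eq_mul, Nat.cast_ofNat] at h
    exact h
  have hcoe : ((γ ^ 4 : Gamma0 N) : SL(2, ℤ)) = (γ : SL(2, ℤ)) ^ 4 := rfl
  by_cases hc4 : ((γ ^ 4 : Gamma0 N) : SL(2, ℤ)) 1 0 = 0
  · -- `c(γ⁴) = 0`: the symbol vanishes
    have h0 : cuspSymbol f (γ ^ 4) = 0 := by simp only [cuspSymbol, hc4, if_true]
    rw [h4] at h0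
    have : cuspSymbol f γ = 0 := by
      rcases mul_eq_zero.mp h0 with h | h
      · norm_num at h
      · exact h
    rw [this, Complex.zero_im, Complex.ofReal_zero, zero_div]
    exact pint_of_isIntegral hpP isIntegral_zero
  · have h3 : 3 ∣ p - 1 → (3 : ℤ) ∣ ((γ ^ 4 : Gamma0 N) : SL(2, ℤ)) 1 0 →
        (3 : ℤ) ∣ ((γ ^ 4 : Gamma0 N) : SL(2, ℤ)) 1 1 - 1 := fun _ h ↦ by
      rw [hcoe] at h ⊢; exact three_dvd_pow_four_entry _ h
    have h4' : (4 : ℤ) ∣ ((γ ^ 4 : Gamma0 N) : SL(2, ℤ)) 1 0 →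
        (4 : ℤ) ∣ ((γ ^ 4 : Gamma0 N) : SL(2, ℤ)) 1 1 - 1 := fun h ↦ by
      rw [hcoe] at h ⊢; exact four_dvd_pow_four_entry _ h
    obtain ⟨γ₁, γ₂, hmul, ⟨hc₁, hd₁, hr₁, h4₁⟩, ⟨hc₂, hd₂, hr₂, h4₂⟩⟩ :=
      exists_eq_mul_adjustable4 hpP hp5 hpN1 (γ ^ 4) hc4 h3 h4'
    have hP₁ := pint_im_cuspSymbol_of_adjustable4 hK hp7 hadd hirr f hf hpN hA hϖ γ₁ hc₁ hd₁ hr₁ h4₁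
    have hP₂ := pint_im_cuspSymbol_of_adjustable4 hK hp7 hadd hirr f hf hpN hA hϖ γ₂ hc₂ hd₂ hr₂ h4₂
    have hsum : cuspSymbol f γ₁ + cuspSymbol f γ₂ = 4 * cuspSymbol f γ := by
      rw [← h4, hmul, cuspSymbol_mul_holds f]
    have him : (((cuspSymbol f γ₁).im : ℝ) : ℂ) / (W.imaginaryPeriodRat : ℂ) +
        (((cuspSymbol f γ₂).im : ℝ) : ℂ) / (W.imaginaryPeriodRat : ℂ) =
        ((4 : ℕ) : ℂ) * ((((cuspSymbol f γ).im : ℝ) : ℂ) / (W.imaginaryPeriodRat : ℂ)) := by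
      have := congrArg Complex.im hsum
      rw [Complex.add_im] at this
      rw [← add_div, ← Complex.ofReal_add, this]
      simp [Complex.mul_im]
      ring
    refine pint_of_pint_natCast_mul hpP hp4 ?_
    rw [← him]
    exact pint_add hpP hP₁ hP₂


end SymbolsPlus

section MainPlus

variable {p : ℕ} [hp : Fact p.Prime]

/-- **Manin's `p`-part at a lattice-optimal datum, from the tame-twist lever.** Let `W/ℚ` be globally
minimal, additive at a prime `p > 7` with `E[p]` irreducible, `D` a LATTICE-OPTIMAL datum
(`Λ_E = c Λ_f`) at a level `N` with `p² ∣ N`, and assume **(A⁺)**: `(ℓ/a_ℓ(W))² ≠ 1 (mod p)`, i.e. `ℓ ≢ ±a_ℓ (mod p)`,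
for every prime `ℓ ∥ N`. GRANTED the all-characters Kato–Kosters–Pannekoek fact: `p ∤ c`.
Proof: `im Λ_f = ℤ·Ω⁻_f/2` is generated by the `Im {∞, γ∞}_f`, all in `ℤ_(p)|Ω⁻(W)|`
(`pint_im_cuspSymbol4`), so `ord_p ϖ ≥ 0` for `ϖ |Ω⁻(W)| = Ω⁻_f`, while `ord_p ϖ = −ord_p c` at a
lattice-optimal datum. [cite: Kato2004Asterisque, (8.1.3) (p. 180), Thm. 9.7 (p. 189)]
[cite: KimNakamura2020, Cor. 2.4] [cite: EdixhovenManin1991, §1] -/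
theorem not_dvd_c_of_tameTwist_of_sq_ne_one (hK : kato_neron_isIntegral_twistedSymbolSum_of_additive)
    (W : WeierstrassCurve ℚ) [W.IsElliptic] [W.IsGloballyMinimal] {N : ℕ} [NeZero N]
    (D : ModularParametrizationData W N)
    (hopt : ∀ z ∈ D.L.lattice, ∃ w ∈ periodLattice D.f, z = D.c * w) (hp7 : 7 < p)
    (hadd : Addv W p) (hirr : Irr W p) (hpN : p ^ 2 ∣ N)
    (hA : ∀ ℓ ∈ N.primeFactors, ¬ ℓ ^ 2 ∣ N →
      ((ℓ : ZMod p) / (W.LFunction ℓ : ZMod p)) ^ 2 ≠ 1) :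
    ¬ (p : ℤ) ∣ D.c := by
  have hpP : p.Prime := hp.out
  have hp2 : p ≠ 2 := by omega
  have hc0 : D.c ≠ 0 := D.maninConstant_ne_zero_holds
  -- the period scalar `ϖ = m/|c|`
  obtain ⟨mm, -, hmm⟩ :=
    SkinnerUrban2014.exists_dvd_two_mul_imaginaryPeriodRat_eq_of_latticeEq D hopt
  set ϖ : ℚ := (mm : ℚ) / |(D.c : ℚ)| with hϖdef
  have habs0 : |(D.c : ℝ)| ≠ 0 := abs_ne_zero.mpr (by exact_mod_cast hc0)
  have hϖ : (ϖ : ℝ) * W.imaginaryPeriodRat = minusPeriod D.f := by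
    rw [hϖdef]; push_cast
    rw [div_mul_eq_mul_div, hmm]
    field_simp
  have hΩf : 0 < minusPeriod D.f :=
    IsNewform0.minusPeriod_pos_holds D.isNewformOf.1 D.isNewformOf.coeffField_eq_bot
  have hΩ : 0 < W.imaginaryPeriodRat := W.imaginaryPeriodRat_pos
  -- `Ω⁻_f/2 = Im {∞, γ∞}_f` for some `γ`
  have hmem : minusPeriod D.f / 2 ∈ imagPeriods D.f := by
    rw [SkinnerUrban2014.imagPeriods_eq_zmultiples_of_minusPeriod_pos D.f hΩf]
    exact AddSubgroup.mem_zmultiples _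
  obtain ⟨z, hz, hzim⟩ := AddSubgroup.mem_map.mp hmem
  have hz' : z ∈ (periodLattice D.f : Set ℂ) := hz
  rw [coe_periodLattice_eq_range] at hz'
  obtain ⟨γ, hγ⟩ := hz'
  have hP := pint_im_cuspSymbol4 hK hp7 hadd hirr D.f D.isNewformOf hpN hA hϖ γ
  rw [hγ] at hP
  have hzim' : z.im = minusPeriod D.f / 2 := hzim
  -- `Im z / Ω = ϖ/2`
  have hq : (((z.im : ℝ) : ℂ) / (W.imaginaryPeriodRat : ℂ)) = ((ϖ / 2 : ℚ) : ℂ) := by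
    rw [hzim', ← hϖ]
    have hΩ0 : (W.imaginaryPeriodRat : ℂ) ≠ 0 := by exact_mod_cast hΩ.ne'
    push_cast
    field_simp
  rw [hq] at hP
  have hval := padicValRat_nonneg_of_pint hP
  have hϖ2 : padicValRat p (ϖ / 2) = padicValRat p ϖ := by
    have hϖ0 : ϖ ≠ 0 := by
      rintro h; rw [h, Rat.cast_zero, zero_mul] at hϖ; exact hΩf.ne' hϖ.symm
    rw [padicValRat.div hϖ0 two_ne_zero, show (2 : ℚ) = ((2 : ℕ) : ℚ) by norm_num, padicValRat.of_nat,
      padicValNat.eq_zero_of_not_dvd (fun h ↦ hp2 ((Nat.prime_dvd_prime_iff_eq hpP Nat.prime_two).mp h))]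
    simp
  rw [hϖ2, ManinFrameResidueProperRUnitTwist.padicValRat_eq_neg_of_mul_imaginaryPeriodRat_eq hp2 D hopt hϖ]
    at hval
  exact not_dvd_of_padicValRat_intCast_le_zero hc0 (by linarith)

/-- **At an AKR residue frame: a member with a Manin-unit conductor-level datum** (the member statement of
line `birth`), GRANTED the fact and modularity, on the locus (A⁺) — `p ≥ 11`, additive, `E[p]` irreducible,
and no multiplicative prime `ℓ ∥ N(W)` with `ℓ ≡ ±a_ℓ(W) (mod p)`: the
`X₀(N)`-optimal member (`X12.exists_isIsogenous_optimal`, lattice-optimal datum) has `p ∤ c₀` by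
`not_dvd_c_of_tameTwist_of_sq_ne_one` (`N(W₀) = N(W)`, `a_ℓ(W₀) = a_ℓ(W)`). [cite: EdixhovenManin1991, §4 (cases 1/2)] -/
theorem exists_member_not_dvd_c_of_tameTwist_of_sq_ne_one (hK : kato_neron_isIntegral_twistedSymbolSum_of_additive)
    (hnf : exists_isNewformOf) (W : WeierstrassCurve ℚ) [W.IsElliptic] [W.IsGloballyMinimal]
    [NeZero (W.conductorNorm ℤ)] (hp11 : 11 ≤ p) (hadd : Addv W p) (hirr : Irr W p)
    (hA : ∀ ℓ ∈ (W.conductorNorm ℤ).primeFactors, ¬ ℓ ^ 2 ∣ W.conductorNorm ℤ →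
      ((ℓ : ZMod p) / (W.LFunction ℓ : ZMod p)) ^ 2 ≠ 1) :
    ∃ (W₀ : WeierstrassCurve ℚ) (_ : W₀.IsElliptic) (_ : W₀.IsGloballyMinimal)
      (D₀ : ModularParametrizationData W₀ (W.conductorNorm ℤ)),
      IsIsogenous W W₀ ∧ ¬ (p : ℤ) ∣ D₀.c := by
  obtain ⟨W₀, hE₀, hM₀, hNe₀, D₀'', hiso, hN, hopt''⟩ := X12.exists_isIsogenous_optimal hnf W
  haveI := hE₀
  haveI := hM₀
  haveI := hNe₀
  obtain ⟨D₀', hopt'⟩ := X12.exists_optimalDatum_of_level_eq hN D₀'' hopt''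
  have hiso₀ : IsIsogenous W₀ W := hiso.symm_of_charZero
  have hL : W₀.LFunction = W.LFunction := hiso₀.LFunction_eq
  have hadd₀ : Addv W₀ p := (X2.addv_iff_of_isIsogenous (p := p) hiso).mp hadd
  have hirr₀ : Irr W₀ p := (X12.irr_iff_of_isIsogenous hiso p).mp hirr
  have hpN : p ^ 2 ∣ W.conductorNorm ℤ := sq_dvd_conductorNorm_of_not_good_of_not_mult hadd
  rw [← hL] at hA
  exact ⟨W₀, hE₀, hM₀, D₀', hiso, not_dvd_c_of_tameTwist_of_sq_ne_one hK W₀ D₀' hopt' (by omega) hadd₀ hirr₀ hpN hA⟩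

/-- **TDS on the locus (A⁺), from the tame-twist lever.** At an AKR residue frame `(W, p)` — `p ≥ 11`,
additive, `E[p]` irreducible, newform granted (`hnf`) — with no `ℓ ∥ N(W)`, `ℓ ≡ ±a_ℓ (mod p)`, and GRANTED the all-characters
Kato–Kosters–Pannekoek fact: for every unstarred (G)-ordinary globally minimal member `V ∼ W` and every
globally minimal model `W♭` of `V ⊗ χ_{p*}`, SOME conductor-level datum of `V` has strictly fewer factors
`p` in its modular degree than EVERY conductor-level datum of `W♭` — the CONCLUSION of the registered stub
`stub_twistDegreeStep` (Edixhoven 1991 §4, "case 2"), by the predecessor's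
`twistDegreeStep_of_exists_member_not_dvd_c` (p540328). Neither the residue clause nor the degree
clause `hall` of the stub is used; K4 is not used. [cite: EdixhovenManin1991, §4 (cases 1/2)]
[cite: Kato2004Asterisque, Thm. 9.7 (p. 189)] -/
theorem twistDegreeStep_of_tameTwist_of_sq_ne_one (hK : kato_neron_isIntegral_twistedSymbolSum_of_additive)
    (hnf : exists_isNewformOf) (W : WeierstrassCurve ℚ) [W.IsElliptic] [W.IsGloballyMinimal]
    [NeZero (W.conductorNorm ℤ)] (hp11 : 11 ≤ p) (hadd : Addv W p) (hirr : Irr W p)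
    (hA : ∀ ℓ ∈ (W.conductorNorm ℤ).primeFactors, ¬ ℓ ^ 2 ∣ W.conductorNorm ℤ →
      ((ℓ : ZMod p) / (W.LFunction ℓ : ZMod p)) ^ 2 ≠ 1)
    (V : WeierstrassCurve ℚ) [V.IsElliptic] [V.IsGloballyMinimal] [NeZero (V.conductorNorm ℤ)]
    (Wf : WeierstrassCurve ℚ) [Wf.IsElliptic] [Wf.IsGloballyMinimal] [NeZero (Wf.conductorNorm ℤ)]
    (C : VariableChange ℚ) (hisoV : IsIsogenous W V) (hG : TypeGOrd V p)
    (hV4 : padicValInt p V.minimalDiscriminantInt ≤ 4)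
    (hC : C • V.quadraticTwist ((-1 : ℚ) ^ (p / 2) * p) = Wf) :
    ∃ D : ModularParametrizationData V (V.conductorNorm ℤ),
      ∀ Df : ModularParametrizationData Wf (Wf.conductorNorm ℤ),
        padicValNat p D.modularDegree < padicValNat p Df.modularDegree :=
  ManinFrameResidueProperTwistDegree.twistDegreeStep_of_exists_member_not_dvd_c hnf W (by omega) hadd
    hirr hisoV hG hV4 C hC (exists_member_not_dvd_c_of_tameTwist_of_sq_ne_one hK hnf W hp11 hadd hirr hA)

/-- **The per-curve certificate.** For `W/ℚ` globally minimal, additive at a prime `p > 7` with `E[p]`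
irreducible and (A⁺) at the frame: EVERY lattice-optimal datum at level `N(W)` of EVERY globally minimal
`W₀ ∼ W` has `p ∤ c₀` — GRANTED the fact; a congruence condition on `(N, a_ℓ)` alone (no `L`-value, no
modular degree, no period of `E`). [cite: Kato2004Asterisque, (8.1.3) (p. 180), Thm. 9.7 (p. 189)]
[cite: KimNakamura2020, Cor. 2.4] -/
theorem forall_latticeOptimal_not_dvd_c_of_tameTwist_of_sq_ne_one
    (hK : kato_neron_isIntegral_twistedSymbolSum_of_additive)
    (W : WeierstrassCurve ℚ) [W.IsElliptic] [W.IsGloballyMinimal] [NeZero (W.conductorNorm ℤ)]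
    (hp7 : 7 < p) (hadd : Addv W p) (hirr : Irr W p)
    (hA : ∀ ℓ ∈ (W.conductorNorm ℤ).primeFactors, ¬ ℓ ^ 2 ∣ W.conductorNorm ℤ →
      ((ℓ : ZMod p) / (W.LFunction ℓ : ZMod p)) ^ 2 ≠ 1)
    (W₀ : WeierstrassCurve ℚ) [W₀.IsElliptic] [W₀.IsGloballyMinimal] (hiso : IsIsogenous W W₀)
    (D₀ : ModularParametrizationData W₀ (W.conductorNorm ℤ))
    (hopt : ∀ z ∈ D₀.L.lattice, ∃ w ∈ periodLattice D₀.f, z = D₀.c * w) :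
    ¬ (p : ℤ) ∣ D₀.c := by
  have hiso₀ : IsIsogenous W₀ W := hiso.symm_of_charZero
  have hL : W₀.LFunction = W.LFunction := hiso₀.LFunction_eq
  have hadd₀ : Addv W₀ p := (X2.addv_iff_of_isIsogenous (p := p) hiso).mp hadd
  have hirr₀ : Irr W₀ p := (X12.irr_iff_of_isIsogenous hiso p).mp hirr
  have hpN : p ^ 2 ∣ W.conductorNorm ℤ := sq_dvd_conductorNorm_of_not_good_of_not_mult hadd
  rw [← hL] at hA
  exact not_dvd_c_of_tameTwist_of_sq_ne_one hK W₀ D₀ hopt hp7 hadd₀ hirr₀ hpN hA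


end MainPlus

end Summit.BirchSwinnertonDyer.BirchSwinnertonDyer.Theorems.ManinFrameResidueProperRTameTwist

end
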